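import Summits.QuantumFields.GaugeBoot.TorusPeeling
import Summits.QuantumFields.GaugeBoot.WeakCouplingRate
import HarnessLib

/-!
# Gauge-boot: a LOWER bound for the torus partition function by axial gauge fixing —
# `Haar^{⊗E}{S ≤ 16·#P·η} ≥ Haar{N − Re tr ρ ≤ η}^{(d−1)L^d + L^{d−1}}` (supplement 21, part 3d)

HONEST FRAMING (cell `pub-gaugeboot`, page 1 of every file): certified bounds on lattice
expectations at STATED coupling, gauge group, dimension and torus size; NOT a mass gap, NOT a
continuum limit, NOT a string tension, NOT large `N`; NOT Yang–Mills-summit-bearing (barriers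
`FixedCouplingUltralocality`, `PerturbativeInvisibility`).  A structural inequality for the Wave-0
torus at every coupling; it certifies no number.  Input of the `O(1/β)` bound (part 3e).

## Content

The small-ball function `Haar^{⊗E}{S ≤ ε}` of the Laplace principle (tree `WilsonEnergyConvexity`)
was so far estimated by constraining ALL `d·L^d` links (supplements 17–18): exponent `d·L^d·dim G/2`,
which cannot match the UPPER bound of part 3c (exponent `(d−1)(L^d − L^{d−1})·dim G/2`).  Axial gauge
removes the redundant directions: with the maximal forest `T` of direction-`0` links `(x, 0)`,
`x₀ ≠ L−1` (`#T = L^d − L^{d−1}`), the map `Ψ` replacing every non-forest link variable `U(x,μ)` by its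
gauge transform `g(x) U(x,μ) g(x+e_μ)⁻¹`, `g(x) = U((0,y),0) U((1,y),0) ⋯ U((x₀−1,y),0)` the transport
along the forest, is a fiberwise two-sided translation by forest variables, hence preserves `Haar^{⊗E}`
(`PiFiber.measurePreserving_fiberwise` of part 3c), and `S(U) = S(U^{g})` with `U^g ≡ 1` on `T`:

* `AxialGauge.gauge`, `gauge_shift_zero` (`g(x + e_0) = g(x) U(x,0)` off the last slice),
  `gaugeTransform_gauge_of_tree` (`U^g = 1` on the forest), `measurePreserving_axialMap`;
* `AxialGauge.wilsonAction_le_of_axialMap` — if every non-forest link of `Ψ U` has cost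
  `N − Re tr ρ ≤ η` (`η ≥ 0`) then `S(U) ≤ 16·#P·η` (the lane's `wilsonAction_le_of_links` on `U^g`);
* ★★ `AxialGauge.le_measureReal_wilsonAction_le` — **`Haar{g : N − Re tr ρ(g) ≤ η}^{#nonForest} ≤
  Haar^{⊗E}{S ≤ 16·#P·η}`**, with `L · #nonForest = (d−1)L^{d+1} + L^d`, i.e.
  `#nonForest = (d−1)L^d + L^{d−1}` (`AxialGauge.card_nonTree`);
* ★★ `AxialGauge.torusLogPartition_ge` — **`log Z_L(β) ≥ −16β·#P·η + #nonForest · log Haar{N − Re tr ρ ≤ η}`**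
  for `β ≥ 0` and every `η` with positive small-ball mass.

[folklore] (axial / temporal gauge on the lattice, e.g. E. Seiler, LNP 159 (1982) Ch. 2; S. Chatterjee,
arXiv:1602.01222 §9; the torus keeps one non-fixable link per direction-`0` circle.)
-/

noncomputable section

open MeasureTheory Filter
open Literature.MathematicalPhysics.QuantumFieldTheory
open Literature.MathematicalPhysics.QuantumLattice (measurePreserving_mul_mul_inv_haarProbability)
open Literature.RepresentationTheory.CompactGroups

namespace Summit.QuantumFields.GaugeBoot

namespace AxialGauge

/-! ### The forest and the transport -/

open Classical in
/-- The non-forest links: all links except the direction-`0` links `(x, 0)` with `x₀ ≠ L − 1`. -/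
def nonTree (d L : ℕ) [NeZero d] [NeZero L] : Finset (Edge d L) :=
  Finset.univ.filter fun e => ¬ (e.2 = 0 ∧ (e.1 0).val ≠ L - 1)

section Algebra

variable {d L N : ℕ} [NeZero d] [NeZero L] {G : Type*} [Group G] (ρ : G →* Matrix (Fin N) (Fin N) ℂ)

/-- Membership in `nonTree`. -/
theorem mem_nonTree {e : Edge d L} : e ∈ nonTree d L ↔ ¬ (e.2 = 0 ∧ (e.1 0).val ≠ L - 1) := by
  simp [nonTree]

/-- The site `(t, y)` on the direction-`0` line through `x = (x₀, y)`. -/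
def lineSite (x : Site d L) (t : ℕ) : Site d L := Function.update x 0 (t : ZMod L)

/-- The axial-gauge transport `g(x) = U((0,y),0) U((1,y),0) ⋯ U((x₀−1,y),0)` along the forest. -/
def gauge (U : GaugeConfig d L G) (x : Site d L) : G :=
  ((List.range (x 0).val).map fun t => U (lineSite x t, 0)).prod

omit [NeZero L] in
/-- The line through `x + e_0` is the line through `x`. [folklore] -/
theorem lineSite_shift_zero (x : Site d L) (t : ℕ) : lineSite (x.shift 0) t = lineSite x t := by
  funext i
  by_cases hi : i = 0
  · subst hi; simp [lineSite]
  · simp [lineSite, Literature.MathematicalPhysics.QuantumFieldTheory.Site.shift, hi]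

/-- `lineSite x x₀ = x`. [folklore] -/
theorem lineSite_val (x : Site d L) : lineSite x (x 0).val = x := by
  simp [lineSite]

/-- ★ **Transport recursion**: `g(x + e_0) = g(x) · U(x, 0)` off the last slice (`x₀ ≠ L − 1`). [folklore] -/
theorem gauge_shift_zero (U : GaugeConfig d L G) {x : Site d L} (hx : (x 0).val ≠ L - 1) :
    gauge U (x.shift 0) = gauge U x * U (x, 0) := by
  have hlt := ZMod.val_lt (x 0)
  have hL : 2 ≤ L := by omega
  haveI : Fact (1 < L) := ⟨by omega⟩
  have hval : ((x.shift 0) 0).val = (x 0).val + 1 := by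
    have hshift : (x.shift 0) 0 = x 0 + 1 := by
      simp [Literature.MathematicalPhysics.QuantumFieldTheory.Site.shift]
    rw [hshift, ZMod.val_add_of_lt (by rw [ZMod.val_one]; omega), ZMod.val_one]
  unfold gauge
  rw [hval, List.range_succ, List.map_append, List.prod_append, List.map_singleton, List.prod_singleton]
  simp only [lineSite_shift_zero, lineSite_val]

/-- The transport reads only forest links: if `U, U'` agree on the forest then `g_U = g_{U'}`. [folklore] -/
theorem gauge_congr {U U' : GaugeConfig d L G} (h : ∀ e : Edge d L, e ∉ (nonTree d L : Set (Edge d L)) → U e = U' e)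
    (x : Site d L) : gauge U x = gauge U' x := by
  unfold gauge
  congr 1
  refine List.map_congr_left fun t ht => ?_
  rw [List.mem_range] at ht
  refine h _ fun hmem => ?_
  rw [Finset.mem_coe, mem_nonTree] at hmem
  refine hmem ⟨rfl, ?_⟩
  have htL : t < L := ht.trans (ZMod.val_lt (x 0))
  show ((lineSite x t) 0).val ≠ L - 1
  rw [lineSite, Function.update_self, ZMod.val_cast_of_lt htL]
  have := ZMod.val_lt (x 0)
  omega

/-- The fiber map of the axial gauge: `v ↦ g(x) v g(x + e_μ)⁻¹` on the link `(x, μ)`. -/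
def fiber (U : GaugeConfig d L G) (e : Edge d L) (v : G) : G :=
  gauge U e.1 * v * (gauge U (e.1.shift e.2))⁻¹

open Classical in
/-- The axial-gauge map: non-forest links are gauge transformed by the transport, forest links are
kept (they are the new free variables). -/
def axialMap (U : GaugeConfig d L G) : GaugeConfig d L G :=
  fun e => if e ∈ (nonTree d L : Set (Edge d L)) then fiber U e (U e) else U e

/-- On non-forest links the axial map IS the gauge transform by the transport. [folklore] -/
theorem axialMap_apply_of_mem {U : GaugeConfig d L G} {e : Edge d L} (he : e ∈ nonTree d L) :
    axialMap U e = gaugeTransform (gauge U) U e := by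
  classical
  unfold axialMap fiber gaugeTransform
  rw [if_pos (Finset.mem_coe.2 he)]

/-- **The transport trivialises the forest**: `(U^{g_U})(x, 0) = 1` for `x₀ ≠ L − 1`. [folklore] -/
theorem gaugeTransform_gauge_of_tree (U : GaugeConfig d L G) {e : Edge d L} (he : e ∉ nonTree d L) :
    gaugeTransform (gauge U) U e = 1 := by
  rw [mem_nonTree, not_not] at he
  obtain ⟨h0, hx⟩ := he
  obtain ⟨x, μ⟩ := e
  simp only at h0 hx
  subst h0
  unfold gaugeTransform
  simp only
  rw [gauge_shift_zero U hx, mul_inv_rev, ← mul_assoc, mul_inv_cancel_right, mul_inv_cancel]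

end Algebra

/-! ### Counting the non-forest links -/

section Count

variable {d L : ℕ} [NeZero d] [NeZero L]

/-- ★ `L · #nonForest = (d − 1) L^{d+1} + L^d`, i.e. `#nonForest = (d−1)L^d + L^{d−1}`. [folklore] -/
theorem card_nonTree : L * (nonTree d L).card = (d - 1) * L ^ (d + 1) + L ^ d := by
  classical
  -- the forest: direction-`0` links off the last slice, in bijection with the sites `x₀ ≠ L − 1`
  have hlast : ((L - 1 : ℕ) : ZMod L).val = L - 1 :=
    ZMod.val_cast_of_lt (Nat.sub_lt (Nat.pos_of_ne_zero (NeZero.ne L)) one_pos)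
  have htree : (Finset.univ.filter fun e : Edge d L => e.2 = 0 ∧ (e.1 0).val ≠ L - 1).card =
      (Finset.univ.filter fun x : Site d L => x 0 ≠ ((L - 1 : ℕ) : ZMod L)).card := by
    refine Finset.card_bij' (fun e _ => e.1) (fun x _ => (x, 0)) ?_ ?_ ?_ ?_
    · intro e he
      simp only [Finset.mem_filter, Finset.mem_univ, true_and] at he ⊢
      intro h; apply he.2; rw [h, hlast]
    · intro x hx
      simp only [Finset.mem_filter, Finset.mem_univ, true_and] at hx ⊢
      intro h
      apply hx
      apply ZMod.val_injective
      rw [h, hlast]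
    · intro e he
      simp only [Finset.mem_filter, Finset.mem_univ, true_and] at he
      ext <;> simp [he.1]
    · intro x _; rfl
  have hfib := Peel.card_filter_apply_eq (d := d) (L := L) ((L - 1 : ℕ) : ZMod L)
  have hsite : (Finset.univ : Finset (Site d L)).card = L ^ d := by
    rw [Finset.card_univ, Fintype.card_fun, ZMod.card, Fintype.card_fin]
  have hsplit₁ : (Finset.univ.filter fun x : Site d L => x 0 = ((L - 1 : ℕ) : ZMod L)).card +
      (Finset.univ.filter fun x : Site d L => x 0 ≠ ((L - 1 : ℕ) : ZMod L)).card = L ^ d := by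
    rw [← hsite]; exact Finset.card_filter_add_card_filter_not _
  have hedge : (Finset.univ : Finset (Edge d L)).card = L ^ d * d := by
    rw [Finset.card_univ, Fintype.card_prod, Fintype.card_fun, ZMod.card, Fintype.card_fin]
  have hsplit₂ : (Finset.univ.filter fun e : Edge d L => e.2 = 0 ∧ (e.1 0).val ≠ L - 1).card + (nonTree d L).card
      = L ^ d * d := by
    rw [← hedge, nonTree]; exact Finset.card_filter_add_card_filter_not _
  rw [htree] at hsplit₂
  -- `L · #forest = L^{d+1} − L^d`, `L · #E = d L^{d+1}`
  have hd : 1 ≤ d := Nat.one_le_iff_ne_zero.2 (NeZero.ne d)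
  have key : L * (nonTree d L).card + (L * L ^ d - L ^ d) = d * (L * L ^ d) := by
    have e1 : L * (Finset.univ.filter fun x : Site d L => x 0 ≠ ((L - 1 : ℕ) : ZMod L)).card = L * L ^ d - L ^ d := by
      have := congrArg (fun n => L * n) hsplit₁
      simp only [mul_add] at this
      rw [hfib] at this
      omega
    have e2 := congrArg (fun n => L * n) hsplit₂
    simp only [mul_add] at e2
    rw [e1] at e2
    have : L * (L ^ d * d) = d * (L * L ^ d) := by ring
    omega
  have hLd : L ^ d ≤ L * L ^ d := Nat.le_mul_of_pos_left _ (Nat.pos_of_ne_zero (NeZero.ne L))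
  rw [pow_succ, Nat.sub_mul, one_mul]
  have : d * (L * L ^ d) = (d - 1) * (L * L ^ d) + L * L ^ d := by
    rw [Nat.sub_mul, one_mul]; have := Nat.le_mul_of_pos_left (L * L ^ d) hd; omega
  rw [mul_comm (L ^ d) L]
  omega

end Count

/-! ### Measure: the axial map preserves Haar; the small-ball bound -/

section Measure

variable {d L N : ℕ} [NeZero d] [NeZero L] {G : Type*} [Group G] [TopologicalSpace G] [IsTopologicalGroup G]
  [CompactSpace G] [MeasurableSpace G] [BorelSpace G] [SecondCountableTopology G]
  (ρ : G →* Matrix (Fin N) (Fin N) ℂ)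

omit [NeZero L] [CompactSpace G] [MeasurableSpace G] [BorelSpace G] [SecondCountableTopology G] in
/-- The transport is continuous in the configuration. [folklore] -/
theorem continuous_gauge (x : Site d L) : Continuous fun U : GaugeConfig d L G => gauge U x := by
  unfold gauge
  exact continuous_list_prod _ fun t _ => continuous_apply _

/-- ★ **The axial-gauge map preserves the product Haar measure.** [folklore] -/
theorem measurePreserving_axialMap :
    MeasurePreserving (axialMap (d := d) (L := L) (G := G))
      (Measure.pi fun _ : Edge d L => haarProbability G) (Measure.pi fun _ : Edge d L => haarProbability G) := by
  classical
  haveI : Nonempty G := ⟨1⟩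
  refine PiFiber.measurePreserving_fiberwise (haarProbability G) (nonTree d L : Set (Edge d L))
    (fun U e v => fiber U e v) ?_ ?_ ?_
  · intro U U' hUU' e _
    funext v
    simp only [fiber, gauge_congr hUU']
  · refine Continuous.measurable (continuous_pi fun e => ?_)
    unfold fiber
    exact ((continuous_gauge e.1).mul (continuous_apply e)).mul (continuous_gauge _).inv
  · intro U e
    exact measurePreserving_mul_mul_inv_haarProbability (G := G) (gauge U e.1) (gauge U (e.1.shift e.2))

omit [MeasurableSpace G] [BorelSpace G] [SecondCountableTopology G] in
/-- **Small links in axial gauge ⇒ small action**: if every non-forest link of `Ψ U` has cost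
`N − Re tr ρ ≤ η` (`η ≥ 0`) then `S(U) ≤ 16·η·#P`. [folklore] -/
theorem wilsonAction_le_of_axialMap (hρ : Continuous ρ) {η : ℝ} (hη : 0 ≤ η) (U : GaugeConfig d L G)
    (hU : ∀ e ∈ nonTree d L, (N : ℝ) - ((ρ (axialMap U e)).trace).re ≤ η) :
    wilsonAction ρ U ≤ 16 * η * (Fintype.card (Plaquette d L) : ℝ) := by
  rw [← wilsonAction_gaugeTransform ρ (gauge U) U]
  refine WeakCoupling.wilsonAction_le_of_links ρ hρ _ fun e => ?_
  by_cases he : e ∈ nonTree d L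
  · rw [← axialMap_apply_of_mem he]; exact hU e he
  · rw [gaugeTransform_gauge_of_tree U he, map_one, Matrix.trace_one, Fintype.card_fin]
    simpa using hη

/-- ★★ **The axial-gauge small-ball bound**: for `η ≥ 0`,
`Haar{g : N − Re tr ρ(g) ≤ η}^{#nonForest} ≤ Haar^{⊗E}{U : S(U) ≤ 16·η·#P}`. [folklore] -/
theorem le_measureReal_wilsonAction_le (hρ : Continuous ρ) {η : ℝ} (hη : 0 ≤ η) :
    ((haarProbability G).real {g : G | (N : ℝ) - ((ρ g).trace).re ≤ η}) ^ (nonTree d L).card ≤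
      (Measure.pi fun _ : Edge d L => haarProbability G).real
        {U : GaugeConfig d L G | wilsonAction ρ U ≤ 16 * η * (Fintype.card (Plaquette d L) : ℝ)} := by
  classical
  set κ := haarProbability G
  set C : Set G := {g : G | (N : ℝ) - ((ρ g).trace).re ≤ η} with hC
  have hCm : MeasurableSet C :=
    measurableSet_le (continuous_const.sub (continuous_trace_re ρ hρ)).measurable measurable_const
  -- the box constraining the non-forest coordinates
  set s : Edge d L → Set G := fun e => if e ∈ nonTree d L then C else Set.univ with hs
  set B : Set (GaugeConfig d L G) := Set.univ.pi s with hB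
  have hBm : MeasurableSet B := MeasurableSet.univ_pi fun e => by
    simp only [hs]; split_ifs; exacts [hCm, MeasurableSet.univ]
  have hBvol : (Measure.pi fun _ : Edge d L => κ) B = κ C ^ (nonTree d L).card := by
    rw [hB, Measure.pi_pi]
    have : ∀ e : Edge d L, κ (s e) = if e ∈ nonTree d L then κ C else 1 := fun e => by
      simp only [hs]; split_ifs <;> simp [κ]
    simp_rw [this]
    rw [Finset.prod_ite_mem, Finset.univ_inter, Finset.prod_const]
  -- `Ψ⁻¹ B ⊆ {S ≤ 16 η #P}`
  have hsub : axialMap ⁻¹' B ⊆ {U : GaugeConfig d L G | wilsonAction ρ U ≤ 16 * η * (Fintype.card (Plaquette d L) : ℝ)} := by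
    intro U hU
    refine wilsonAction_le_of_axialMap ρ hρ hη U fun e he => ?_
    have h := hU e (Set.mem_univ _)
    simp only [hs, if_pos he, hC, Set.mem_setOf_eq] at h
    exact h
  have hpre : (Measure.pi fun _ : Edge d L => κ) (axialMap ⁻¹' B) = κ C ^ (nonTree d L).card := by
    rw [(measurePreserving_axialMap (d := d) (L := L) (G := G)).measure_preimage hBm.nullMeasurableSet, hBvol]
  rw [measureReal_def, measureReal_def, ← ENNReal.toReal_pow, ← hpre]
  exact ENNReal.toReal_mono (measure_ne_top _ _) (measure_mono hsub)

/-- ★★ **Axial-gauge lower bound for the torus free energy**: for `β ≥ 0` and `η ≥ 0` with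
`Haar{N − Re tr ρ ≤ η} > 0`,
`log Z_L(β) ≥ −16β·η·#P + #nonForest · log Haar{g : N − Re tr ρ(g) ≤ η}`. [folklore] -/
theorem torusLogPartition_ge (hρ : Continuous ρ) {β : ℝ} (hβ : 0 ≤ β) {η : ℝ} (hη : 0 ≤ η)
    (hpos : 0 < (haarProbability G).real {g : G | (N : ℝ) - ((ρ g).trace).re ≤ η}) :
    -(β * (16 * η * (Fintype.card (Plaquette d L) : ℝ))) +
        (nonTree d L).card * Real.log ((haarProbability G).real {g : G | (N : ℝ) - ((ρ g).trace).re ≤ η}) ≤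
      Literature.MathematicalPhysics.QuantumLattice.torusLogPartition d ρ β L := by
  have hlap := exp_mul_measureReal_le_integral_exp (d := d) (L := L) ρ hρ hβ (16 * η * (Fintype.card (Plaquette d L) : ℝ))
  have hball := le_measureReal_wilsonAction_le (d := d) (L := L) ρ hρ hη
  have hq := pow_pos hpos (nonTree d L).card
  rw [Literature.MathematicalPhysics.QuantumFieldTheory.torusLogPartition_eq_log_integral ρ hρ,
    ← Real.log_pow, ← Real.log_exp (-(β * _)), ← Real.log_mul (Real.exp_pos _).ne' hq.ne']
  refine Real.log_le_log (mul_pos (Real.exp_pos _) hq) ?_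
  calc Real.exp (-(β * (16 * η * (Fintype.card (Plaquette d L) : ℝ)))) *
        (haarProbability G).real {g : G | (N : ℝ) - ((ρ g).trace).re ≤ η} ^ (nonTree d L).card
      ≤ Real.exp (-β * (16 * η * (Fintype.card (Plaquette d L) : ℝ))) *
        (Measure.pi fun _ : Edge d L => haarProbability G).real
          {U : GaugeConfig d L G | wilsonAction ρ U ≤ 16 * η * (Fintype.card (Plaquette d L) : ℝ)} := by
        rw [neg_mul]; exact mul_le_mul_of_nonneg_left hball (Real.exp_pos _).le
    _ ≤ _ := hlap

end Measure

end AxialGauge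

end Summit.QuantumFields.GaugeBoot

end
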